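import Literature.NumberTheory.DiophantineGeometry.GenEllImageModLContainsSL2
import Literature.NumberTheory.DiophantineGeometry.GenEllMellReduction
import Literature.NumberTheory.DiophantineGeometry.LocalReductionHasMultiplicativeReductionAtProofs
import Literature.NumberTheory.DiophantineGeometry.LocalReductionFiniteBadPlacesProofs
import Literature.NumberTheory.DiophantineGeometry.LocalReductionIsIntegralAtProofs
import Literature.NumberTheory.DiophantineGeometry.MinimalDiscriminantNormProofs
import Literature.NumberTheory.EllipticCurves.Curve37aRootNumber
import Mathlib.NumberTheory.Padics.HeightOneSpectrum
import HarnessLib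

/-!
# [GenEll] §3 predicates INHABITED at an honest arithmetic model: the curve `37a`

S. Mochizuki, *Arithmetic elliptic curves in general position*, Math. J. Okayama Univ. **52** (2010)
[cite: MochizukiGenEll2010], §3 pp. 15–19: Lemma 3.5 (`l`-cyclic subgroup schemes, p. 17),
Lemma 3.7 (p. 18: "`E_L` … with semi-stable reduction at all the finite primes of `L` … has at least
one prime of [bad] multiplicative reduction") and Theorem 3.8 (p. 19: "the image of the Galois
representation `Gal(Q̄/L) → GL₂(ℤ_l)` associated to `E_L` contains `SL₂(ℤ_l)`").

The tree renders the HYPOTHESES / CONCLUSION SCHEMATA of these statements as parametrised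
predicates on a presented curve `P : EllPoint` (`GenEllFullGalois.lean`, `GenEllLCyclic.lean`):
`EllPoint.HasMultPlace`, `EllPoint.IsSemistable`, `EllPoint.HasPotMultPlace`,
`EllPoint.AdmitsLCyclic`, `EllPoint.ImageModLContainsSL2`. Their universal closures are refuted in
the tree at `y² + y = x³` (`GenEllFactListCurveSchemas.lean`); what was missing is a CLOSED kernel
INHABITANT of the positive predicates (the census of kernel producers lists only conditional ones),
i.e. a non-vacuity certificate for "condition (a)" of Lemma 3.7 / Theorem 3.8 and for the conclusion
schema (P6) at a prime level. This proof-only file supplies them at ONE honest example, the elliptic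
curve `37a : y² + y = x³ − x` over `ℚ` (the tree's `Curve37a.E`; Cremona's `37A1`, `Δ = 37`,
`c₄ = 48`, conductor `37`), presented as the point `⟨ℚ, Curve37a.E⟩ : EllPoint` of `M_ell(Q̄)`:

* `curve37a_hasMultiplicativeReductionAt_of_mem` — at the place `v` of `𝓞_ℚ` above `37` the
  reduction is multiplicative (`v(c₄) = v(48)` a unit, `v(Δ) = v(37) < 1`; Silverman AEC VII.5
  Prop. 5.1(b) = the tree's `hasMultiplicativeReductionAt_of_valuation_c₄_eq_one`); hence
  `hasMultPlace_curve37a : (⟨ℚ, 37a⟩).HasMultPlace`, `hasPotMultPlace_curve37a`, and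
  `isSemistable_curve37a` (good reduction off `37` since `Δ = 37` is a unit there);
* `ordMinimalDiscriminant_curve37a` — `ord_v(Δ_min) = 1` at that place (the model is minimal:
  `v(c₄) = 0 < 4`);
* `not_admitsLCyclic_two_curve37a` — `37a` admits NO `2`-cyclic subgroup scheme over `ℚ`: a
  `Γ_ℚ`-stable subgroup of order `2` of `E[2]` is generated by a `Γ_ℚ`-fixed point of order `2`, which
  by Galois descent is rational with `2y + 1 = 0`, so `x³ − x = −1/4`, i.e. `4x³ − 4x + 1 = 0` — no
  rational solution (parity);
* `imageModLContainsSL2_two_curve37a` — **the image of `Γ_ℚ` in `Aut(E[2]) ≅ GL₂(𝔽₂)` contains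
  `SL₂(𝔽₂)`** (so is all of `GL₂(𝔽₂)`), by the tree's (P2)+(P4) ⇒ (P6) theorem
  `EllPoint.imageModLContainsSL2_of_not_admitsLCyclic_of_hasMultiplicativeReductionAt` (Tate-curve
  transvection at `v = 37 ∤ 2` with `2 ∤ ord_v(Δ_min) = 1`, plus irreducibility from the absence of a
  `2`-cyclic subgroup scheme) — the first closed instance of `EllPoint.ImageModLContainsSL2` at a
  prime level in the tree;
* `imageModLContainsSL2_one` — the degenerate level `l = 1` holds for every presented curve
  (`E[1] = 0`).

Proof-only; no definitions, no named-fact hypotheses; classical and undisputed; nothing here bears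
on [IUTchIII] Cor. 3.12 (FACT-LIST rows F-2744 / F-2746 / F-2753 / F-2745 / F-2754: instance forms).
-/

noncomputable section

open scoped Classical
open NumberField IsDedekindDomain WeierstrassCurve

namespace Literature.NumberTheory.DiophantineGeometry.GenEll

open Literature.NumberTheory.EllipticCurves

/-! ## The place above `37` and the reduction of `37a` there -/

/-- `37a` has integral coefficients (`0, 0, 1, −1, 0`), so it is integral at every finite place of
`ℚ`. [cite: CremonaAlgorithms1997, Table 1 (curve 37A1)] -/
theorem curve37a_isIntegralAt (v : HeightOneSpectrum (𝓞 ℚ)) : Curve37a.E.IsIntegralAt v := by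
  rw [isIntegralAt_iff_valuation_le_one]
  refine ⟨?_, ?_, ?_, ?_, ?_⟩ <;> simp [Curve37a.E]

/-- A proper ideal of `𝓞_ℚ` containing `37` does not contain `48` (`13·37 − 10·48 = 1`).
[cite: CremonaAlgorithms1997, Table 1 (curve 37A1)] -/
theorem not_mem_48_of_mem_37 {v : HeightOneSpectrum (𝓞 ℚ)} (h37 : (37 : 𝓞 ℚ) ∈ v.asIdeal) :
    (48 : 𝓞 ℚ) ∉ v.asIdeal := by
  intro h48
  have hone : (1 : 𝓞 ℚ) ∈ v.asIdeal := by
    have := v.asIdeal.sub_mem (v.asIdeal.mul_mem_left 13 h37) (v.asIdeal.mul_mem_left 10 h48)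
    convert this using 1
    norm_num
  exact v.isPrime.ne_top ((Ideal.eq_top_iff_one _).mpr hone)

/-- A proper ideal of `𝓞_ℚ` containing `37` does not contain `2` (`37 − 18·2 = 1`).
[cite: CremonaAlgorithms1997, Table 1 (curve 37A1)] -/
theorem not_mem_two_of_mem_37 {v : HeightOneSpectrum (𝓞 ℚ)} (h37 : (37 : 𝓞 ℚ) ∈ v.asIdeal) :
    (2 : 𝓞 ℚ) ∉ v.asIdeal := by
  intro h2
  have hone : (1 : 𝓞 ℚ) ∈ v.asIdeal := by
    have := v.asIdeal.sub_mem h37 (v.asIdeal.mul_mem_left 18 h2)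
    convert this using 1
    norm_num
  exact v.isPrime.ne_top ((Ideal.eq_top_iff_one _).mpr hone)

/-- At a place `v ∋ 37`: `v(Δ(37a)) = v(37) < 1`. [cite: SilvermanAEC2009, VII.5 Prop. 5.1(b)] -/
theorem curve37a_valuation_Δ_lt_one {v : HeightOneSpectrum (𝓞 ℚ)} (h37 : (37 : 𝓞 ℚ) ∈ v.asIdeal) :
    v.valuation ℚ Curve37a.E.Δ < 1 := by
  rw [Curve37a.E_Δ, ← map_ofNat (algebraMap (𝓞 ℚ) ℚ) 37]
  exact (v.valuation_lt_one_iff_mem _).mpr h37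

/-- At a place `v ∋ 37`: `c₄(37a) = 48` is a `v`-unit. [cite: SilvermanAEC2009, VII.5 Prop. 5.1(b)] -/
theorem curve37a_valuation_c₄_eq_one {v : HeightOneSpectrum (𝓞 ℚ)} (h37 : (37 : 𝓞 ℚ) ∈ v.asIdeal) :
    v.valuation ℚ Curve37a.E.c₄ = 1 := by
  rw [Curve37a.E_c₄, ← map_ofNat (algebraMap (𝓞 ℚ) ℚ) 48, HeightOneSpectrum.valuation_of_algebraMap]
  exact HeightOneSpectrum.intValuation_eq_one_iff.mpr (not_mem_48_of_mem_37 h37)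

/-- Off `37`: `Δ(37a) = 37` is a `v`-unit. [cite: SilvermanAEC2009, VII.5 Prop. 5.1(a)] -/
theorem curve37a_valuation_Δ_eq_one {v : HeightOneSpectrum (𝓞 ℚ)} (h37 : (37 : 𝓞 ℚ) ∉ v.asIdeal) :
    v.valuation ℚ Curve37a.E.Δ = 1 := by
  rw [Curve37a.E_Δ, ← map_ofNat (algebraMap (𝓞 ℚ) ℚ) 37, HeightOneSpectrum.valuation_of_algebraMap]
  exact HeightOneSpectrum.intValuation_eq_one_iff.mpr h37

/-- **`37a` has multiplicative reduction at the place above `37`** (`v(c₄) = 1`, `v(Δ) < 1` for the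
integral model; Silverman AEC VII.5 Prop. 5.1(b), the tree's
`hasMultiplicativeReductionAt_of_valuation_c₄_eq_one`, here over `A = 𝓞_ℚ` as `EllPoint` requires).
[cite: SilvermanAEC2009, VII.5 Prop. 5.1(b)] -/
theorem curve37a_hasMultiplicativeReductionAt_of_mem {v : HeightOneSpectrum (𝓞 ℚ)}
    (h37 : (37 : 𝓞 ℚ) ∈ v.asIdeal) : Curve37a.E.HasMultiplicativeReductionAt v :=
  hasMultiplicativeReductionAt_of_valuation_c₄_eq_one (curve37a_isIntegralAt v)
    (curve37a_valuation_c₄_eq_one h37) (curve37a_valuation_Δ_lt_one h37)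

/-- **`37a` has good reduction at every place not above `37`** (`Δ = 37` is a unit there;
Silverman AEC VII.5 Prop. 5.1(a), the tree's `hasGoodReductionAt_of_valuation_Δ_eq_one_holds`).
[cite: SilvermanAEC2009, VII.5 Prop. 5.1(a)] -/
theorem curve37a_hasGoodReductionAt_of_not_mem {v : HeightOneSpectrum (𝓞 ℚ)}
    (h37 : (37 : 𝓞 ℚ) ∉ v.asIdeal) : Curve37a.E.HasGoodReductionAt v :=
  hasGoodReductionAt_of_valuation_Δ_eq_one_holds v Curve37a.E (curve37a_isIntegralAt v)
    (curve37a_valuation_Δ_eq_one h37)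

/-- The place of `𝓞_ℚ` above `37` (through Mathlib's `Rat.HeightOneSpectrum.primesEquiv`) contains
`37`. [cite: CremonaAlgorithms1997, Table 1 (curve 37A1)] -/
theorem mem_primesEquiv_symm_37 :
    (37 : 𝓞 ℚ) ∈ ((Rat.HeightOneSpectrum.primesEquiv (R := 𝓞 ℚ)).symm ⟨37, by norm_num⟩).asIdeal := by
  set v := (Rat.HeightOneSpectrum.primesEquiv (R := 𝓞 ℚ)).symm ⟨37, by norm_num⟩ with hv
  have hgen : Rat.HeightOneSpectrum.natGenerator v = 37 :=
    congrArg Subtype.val ((Rat.HeightOneSpectrum.primesEquiv (R := 𝓞 ℚ)).apply_symm_apply ⟨37, _⟩)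
  have h : ((37 : ℕ) : 𝓞 ℚ) ∈ v.asIdeal := by
    rw [← Ideal.apply_mem_of_equiv_iff (f := Rat.IsIntegralClosure.intEquiv (𝓞 ℚ)), map_natCast,
      ← Rat.HeightOneSpectrum.natGenerator_dvd_iff, hgen]
  exact_mod_cast h

/-- The place above `37` is the ideal `(37)` of `𝓞_ℚ`. [cite: CremonaAlgorithms1997, Table 1 (curve 37A1)] -/
theorem primesEquiv_symm_37_asIdeal :
    ((Rat.HeightOneSpectrum.primesEquiv (R := 𝓞 ℚ)).symm ⟨37, by norm_num⟩).asIdeal =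
      Ideal.span {(37 : 𝓞 ℚ)} := by
  set v := (Rat.HeightOneSpectrum.primesEquiv (R := 𝓞 ℚ)).symm ⟨37, by norm_num⟩ with hv
  have hgen : Rat.HeightOneSpectrum.natGenerator v = 37 :=
    congrArg Subtype.val ((Rat.HeightOneSpectrum.primesEquiv (R := 𝓞 ℚ)).apply_symm_apply ⟨37, _⟩)
  have hspan := Rat.HeightOneSpectrum.span_natGenerator v
  rw [hgen] at hspan
  -- pull `span {37} = map e v` back along the ring isomorphism `e : 𝓞 ℚ ≃+* ℤ`
  rw [← v.asIdeal.comap_map_of_bijective _ (Rat.IsIntegralClosure.intEquiv (𝓞 ℚ)).bijective,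
    ← hspan, ← Ideal.map_symm, Ideal.map_span, Set.image_singleton, map_natCast]
  norm_cast

/-- **`ord_v(Δ_min(37a)) = 1` at the place above `37`**: the integral model `y² + y = x³ − x` is
minimal at `v` (`v(c₄) = 0 < 4`, Silverman AEC VII.1 Rmk. 1.1) and `v(Δ) = v(37) = 1` additively.
[cite: SilvermanAEC2009, VII.1 Remark 1.1] -/
theorem ordMinimalDiscriminant_curve37a :
    Curve37a.E.ordMinimalDiscriminant
      ((Rat.HeightOneSpectrum.primesEquiv (R := 𝓞 ℚ)).symm ⟨37, by norm_num⟩) = 1 := by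
  set v := (Rat.HeightOneSpectrum.primesEquiv (R := 𝓞 ℚ)).symm ⟨37, by norm_num⟩ with hv
  have h37 : (37 : 𝓞 ℚ) ∈ v.asIdeal := mem_primesEquiv_symm_37
  have hmin : Curve37a.E.IsMinimalAt v :=
    isMinimalAt_of_lt_valuation_c₄ (curve37a_isIntegralAt v)
      (by rw [curve37a_valuation_c₄_eq_one h37, ← WithZero.exp_zero]
          exact WithZero.exp_lt_exp.mpr (by norm_num))
  have h1 := valuation_Δ_eq_of_isMinimalAt_holds v Curve37a.E hmin
  have h2 : v.valuation ℚ Curve37a.E.Δ = WithZero.exp (-1 : ℤ) := by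
    rw [Curve37a.E_Δ, ← map_ofNat (algebraMap (𝓞 ℚ) ℚ) 37, HeightOneSpectrum.valuation_of_algebraMap]
    exact v.intValuation_singleton (by norm_num) primesEquiv_symm_37_asIdeal
  rw [h1, WithZero.exp_inj, neg_inj] at h2
  exact_mod_cast h2

/-! ## The [GenEll] §3 hypotheses at `[37a] ∈ M_ell(Q̄)` -/

/-- **F-2744 inhabited** — [GenEll] Lemma 3.7's / Theorem 3.8 (a)'s hypothesis "`E_L` has at least
one prime of [bad] multiplicative reduction" HOLDS for `37a` over `ℚ` (the prime `37`).
[cite: MochizukiGenEll2010, Lem 3.7 p.18] -/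
theorem hasMultPlace_curve37a : (⟨ℚ, Curve37a.E⟩ : EllPoint).HasMultPlace :=
  ⟨(Rat.HeightOneSpectrum.primesEquiv (R := 𝓞 ℚ)).symm ⟨37, by norm_num⟩,
    curve37a_hasMultiplicativeReductionAt_of_mem mem_primesEquiv_symm_37⟩

/-- `EllPoint.HasMultPlace` is inhabited. [cite: MochizukiGenEll2010, Lem 3.7 p.18] -/
theorem exists_hasMultPlace : ∃ P : EllPoint, P.HasMultPlace := ⟨_, hasMultPlace_curve37a⟩

/-- **F-2753 inhabited** — the standing hypothesis of [GenEll] §3 "`E → Spec(𝓞_F)` semi-abelian",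
i.e. semistable reduction at every finite prime, HOLDS for `37a` over `ℚ`: multiplicative at `37`,
good elsewhere. [cite: MochizukiGenEll2010, §3 p.16] -/
theorem isSemistable_curve37a : (⟨ℚ, Curve37a.E⟩ : EllPoint).IsSemistable := by
  intro v
  by_cases h37 : (37 : 𝓞 ℚ) ∈ v.asIdeal
  · exact Or.inr (curve37a_hasMultiplicativeReductionAt_of_mem h37)
  · exact Or.inl (curve37a_hasGoodReductionAt_of_not_mem h37)

/-- `EllPoint.IsSemistable ∧ EllPoint.HasMultPlace` is jointly inhabited (condition (a)'s curve-side
hypotheses of Lemma 3.7 are consistent). [cite: MochizukiGenEll2010, Lem 3.7 p.18] -/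
theorem exists_isSemistable_and_hasMultPlace : ∃ P : EllPoint, P.IsSemistable ∧ P.HasMultPlace :=
  ⟨_, isSemistable_curve37a, hasMultPlace_curve37a⟩

/-- **F-2745 inhabited** — Theorem 3.8 (a)'s hypothesis "`E_L` has at least one prime of potentially
multiplicative reduction" (`ord_v(j) < 0`, positive local height) HOLDS for `37a` (at `37`, where the
reduction is multiplicative: the tree's `localHeight_pos_of_hasMultiplicativeReductionAt`).
[cite: MochizukiGenEll2010, Thm 3.8 p.19] -/
theorem hasPotMultPlace_curve37a : (⟨ℚ, Curve37a.E⟩ : EllPoint).HasPotMultPlace :=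
  ⟨(Rat.HeightOneSpectrum.primesEquiv (R := 𝓞 ℚ)).symm ⟨37, by norm_num⟩,
    EllPoint.localHeight_pos_of_hasMultiplicativeReductionAt _ _
      (curve37a_hasMultiplicativeReductionAt_of_mem mem_primesEquiv_symm_37)⟩

/-! ## No `2`-cyclic subgroup scheme on `37a` -/

/-- The coefficients of `37a` base-changed to `Q̄`: `a₁ = a₂ = a₆ = 0`, `a₃ = 1`, `a₄ = −1`.
[cite: CremonaAlgorithms1997, Table 1 (curve 37A1)] -/
theorem curve37a_baseChange_coeffs :
    (Curve37a.E.baseChange (AlgebraicClosure ℚ)).toAffine.a₁ = 0 ∧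
    (Curve37a.E.baseChange (AlgebraicClosure ℚ)).toAffine.a₂ = 0 ∧
    (Curve37a.E.baseChange (AlgebraicClosure ℚ)).toAffine.a₃ = 1 ∧
    (Curve37a.E.baseChange (AlgebraicClosure ℚ)).toAffine.a₄ = -1 ∧
    (Curve37a.E.baseChange (AlgebraicClosure ℚ)).toAffine.a₆ = 0 := by
  simp [Curve37a.E, WeierstrassCurve.baseChange]

/-- `negY` on `37a` over `Q̄`: `−(x, y) = (x, −y − 1)`. [cite: CremonaAlgorithms1997, Table 1 (curve 37A1)] -/
theorem negY_curve37a (x y : AlgebraicClosure ℚ) :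
    (Curve37a.E.baseChange (AlgebraicClosure ℚ)).toAffine.negY x y = -y - 1 := by
  obtain ⟨h1, -, h3, -, -⟩ := curve37a_baseChange_coeffs
  rw [Affine.negY, h1, h3]
  ring

/-- `4x³ − 4x + 1 = 0` has no rational solution (write `x = a/b` in lowest terms:
`4a³ − 4ab² + b³ = 0` forces `2 ∣ b`, then `2 ∣ a`). Equivalently the `2`-division cubic of `37a`
has no rational root. [cite: CremonaAlgorithms1997, Table 1 (curve 37A1)] -/
theorem rat_no_root_two_division_curve37a (x : ℚ) : 4 * x ^ 3 - 4 * x + 1 ≠ 0 := by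
  intro h
  -- clear denominators: `4 a³ - 4 a b² + b³ = 0` with `a = num x`, `b = den x` coprime
  set a : ℤ := x.num with ha
  set b : ℤ := (x.den : ℤ) with hb
  have hb0 : (b : ℚ) ≠ 0 := by
    rw [hb]; exact_mod_cast x.den_nz
  have hx : x = (a : ℚ) / (b : ℚ) := by
    rw [ha, hb]; exact_mod_cast (Rat.num_div_den x).symm
  have hint : (4 * a ^ 3 - 4 * a * b ^ 2 + b ^ 3 : ℤ) = 0 := by
    have h' : (4 * (a : ℚ) ^ 3 - 4 * (a : ℚ) * (b : ℚ) ^ 2 + (b : ℚ) ^ 3) = 0 := by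
      have := congrArg (fun t => t * (b : ℚ) ^ 3) h
      simp only [zero_mul] at this
      rw [hx] at this
      field_simp at this
      linear_combination this
    exact_mod_cast h'
  have hcop : Int.gcd a b = 1 := by
    rw [ha, hb]
    exact x.reduced
  -- `2 ∣ b`
  have h2b : (2 : ℤ) ∣ b := by
    have h3 : (2 : ℤ) ∣ b ^ 3 := ⟨2 * a * b ^ 2 - 2 * a ^ 3, by linear_combination hint⟩
    exact Int.prime_two.dvd_of_dvd_pow h3
  obtain ⟨c, hc⟩ := h2b
  -- then `2 ∣ a`
  have h2a : (2 : ℤ) ∣ a := by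
    have h3 : (2 : ℤ) ∣ a ^ 3 := by
      refine ⟨2 * a * c ^ 2 - c ^ 3, ?_⟩
      have h16 : 4 * a ^ 3 - 16 * a * c ^ 2 + 8 * c ^ 3 = 0 := by
        rw [hc] at hint; linear_combination hint
      have h4 : (4 : ℤ) * a ^ 3 = 4 * (2 * (2 * a * c ^ 2 - c ^ 3)) := by linear_combination h16
      exact mul_left_cancel₀ (by norm_num) h4
    exact Int.prime_two.dvd_of_dvd_pow h3
  have : (2 : ℤ) ∣ (Int.gcd a b : ℤ) := Int.dvd_coe_gcd h2a ⟨c, hc⟩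
  rw [hcop] at this
  norm_num at this

/-- `37a` has no `Γ_ℚ`-fixed geometric point of order `2`: such a point `(x, y)` has `2y + 1 = 0` and
rational coordinates (Galois descent), so `x³ − x = y² + y = −1/4` with `x ∈ ℚ`, impossible.
[cite: MochizukiGenEll2010, Lem 3.5 p.17] -/
theorem no_fixed_two_torsion_curve37a (P : Curve37a.E.geomPoints) (hP0 : P ≠ 0)
    (h2 : P + P = 0) (hfix : ∀ σ : Field.absoluteGaloisGroup ℚ, σ • P = P) : False := by
  -- `AlgebraicClosure ℚ` carries two (definitionally equal) `ℚ`-algebra structures; register the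
  -- Galois instances for the one found by instance search here.
  haveI : Algebra.IsAlgebraic ℚ (AlgebraicClosure ℚ) := AlgebraicClosure.isAlgebraic ℚ
  haveI : IsAlgClosure ℚ (AlgebraicClosure ℚ) := ⟨inferInstance, inferInstance⟩
  haveI : IsGalois ℚ (AlgebraicClosure ℚ) := IsGalois.mk
  obtain ⟨h1, h2c, h3, h4, h6⟩ := curve37a_baseChange_coeffs
  change (Curve37a.E.baseChange (AlgebraicClosure ℚ)).toAffine.Point at P
  rcases P with _ | ⟨x, y, hxy⟩
  · exact hP0 rfl
  · -- `2y + 1 = 0`: otherwise `P + P` is an affine point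
    have h2' : (Affine.Point.some x y hxy :
        (Curve37a.E.baseChange (AlgebraicClosure ℚ)).toAffine.Point)
          + Affine.Point.some x y hxy = 0 := h2
    have hy : y = (Curve37a.E.baseChange (AlgebraicClosure ℚ)).toAffine.negY x y := by
      by_contra hy
      rw [Affine.Point.add_self_of_Y_ne hy] at h2'
      exact Affine.Point.some_ne_zero _ h2'
    rw [negY_curve37a] at hy
    -- the equation `y² + y = x³ - x`
    have heq : y ^ 2 + y = x ^ 3 - x := by
      have := hxy.1
      rw [Affine.equation_iff, h1, h2c, h3, h4, h6] at this
      linear_combination this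
    -- `x` is fixed by `Γ_ℚ`, hence rational
    have hx : ∀ σ : AlgebraicClosure ℚ ≃ₐ[ℚ] AlgebraicClosure ℚ, σ x = x := by
      intro σ
      have := hfix σ
      change Affine.Point.map (σ : AlgebraicClosure ℚ →ₐ[ℚ] AlgebraicClosure ℚ)
        (Affine.Point.some x y hxy) = Affine.Point.some x y hxy at this
      rw [Affine.Point.map_some] at this
      have hboth : σ x = x ∧ σ y = y := by
        simpa only [Affine.Point.some.injEq, AlgEquiv.coe_toAlgHom] using this
      exact hboth.1
    obtain ⟨x₀, rfl⟩ := (InfiniteGalois.mem_range_algebraMap_iff_fixed x).mpr hx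
    -- `4 x₀³ - 4 x₀ + 1 = 0` in `ℚ`
    have hy' : y = -1 / 2 := by linear_combination hy / 2
    rw [hy'] at heq
    have hcubic : algebraMap ℚ (AlgebraicClosure ℚ) (4 * x₀ ^ 3 - 4 * x₀ + 1)
        = algebraMap ℚ (AlgebraicClosure ℚ) 0 := by
      rw [map_zero]
      simp only [map_add, map_sub, map_mul, map_pow, map_one, map_ofNat]
      linear_combination (-4 : AlgebraicClosure ℚ) * heq
    exact rat_no_root_two_division_curve37a x₀
      ((algebraMap ℚ (AlgebraicClosure ℚ)).injective hcubic)

/-- **`37a` admits NO `2`-cyclic subgroup scheme over `ℚ`** (no `Γ_ℚ`-stable subgroup of order `2`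
of `E[2](Q̄)`; its `2`-division cubic `4x³ − 4x + 1` has no rational root) — a negative instance of
`EllPoint.AdmitsLCyclic` (F-2754) at `l = 2`, and the irreducibility input (P2) for `(P6)` below.
[cite: MochizukiGenEll2010, Lem 3.5 p.17] -/
theorem not_admitsLCyclic_two_curve37a : ¬ (⟨ℚ, Curve37a.E⟩ : EllPoint).AdmitsLCyclic 2 := by
  rintro ⟨H, hH, hcard⟩
  obtain ⟨T, hT0, huniq⟩ := (Nat.card_eq_two_iff' (0 : H)).mp hcard
  -- the underlying geometric point
  set P : Curve37a.E.geomPoints :=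
    ((T : ↥(Curve37a.E.geomTorsion ((2 : ℕ) : ℤ))) : Curve37a.E.geomPoints) with hPdef
  have hP0 : P ≠ 0 := fun h => hT0 (Subtype.ext (Subtype.ext h))
  have hPtors : (2 : ℕ) • P = 0 :=
    AddSubgroup.torsionBy.nsmul_iff.mp (T : ↥(Curve37a.E.geomTorsion ((2 : ℕ) : ℤ))).2
  have h2 : P + P = 0 := by rwa [two_nsmul] at hPtors
  have hfix : ∀ σ : Field.absoluteGaloisGroup ℚ, σ • P = P := by
    intro σ
    have hmem : σ • (T : ↥(Curve37a.E.geomTorsion ((2 : ℕ) : ℤ))) ∈ H := hH σ _ T.2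
    have hne : (⟨σ • (T : ↥(Curve37a.E.geomTorsion ((2 : ℕ) : ℤ))), hmem⟩ : H) ≠ 0 := by
      intro h0
      apply hT0
      have h0' : σ • (T : ↥(Curve37a.E.geomTorsion ((2 : ℕ) : ℤ))) = 0 :=
        congrArg Subtype.val h0
      rw [smul_eq_zero_iff_eq] at h0'
      exact Subtype.ext h0'
    exact congrArg
      (fun z : H => ((z : ↥(Curve37a.E.geomTorsion ((2 : ℕ) : ℤ))) : Curve37a.E.geomPoints))
      (huniq _ hne)
  exact no_fixed_two_torsion_curve37a P hP0 h2 hfix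

/-! ## The mod-`2` Galois image of `37a` contains `SL₂(𝔽₂)` -/

/-- **F-2746 inhabited at a prime level — the image of `Γ_ℚ` in `Aut(37a[2]) ≅ GL₂(𝔽₂)` contains
`SL₂(𝔽₂)`** (every determinant-`1` `𝔽₂`-linear automorphism of `E[2](Q̄)` is a Galois element; as
`SL₂(𝔽₂) = GL₂(𝔽₂)` the mod-`2` representation of `37a` is surjective). Obtained from the tree's
(P2)+(P4) ⇒ (P6) theorem ([IUTchIV] Cor. 2.2 step (P6) / [GenEll] Thm. 3.8 "final portion"): no
`2`-cyclic subgroup scheme (`not_admitsLCyclic_two_curve37a`) and the Tate-curve transvection at the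
multiplicative prime `v = 37 ∤ 2` with `2 ∤ ord_v(Δ_min) = 1`.
[cite: MochizukiGenEll2010, Thm 3.8 p.19] -/
theorem imageModLContainsSL2_two_curve37a : (⟨ℚ, Curve37a.E⟩ : EllPoint).ImageModLContainsSL2 2 := by
  haveI : Fact (Nat.Prime 2) := ⟨Nat.prime_two⟩
  refine EllPoint.imageModLContainsSL2_of_not_admitsLCyclic_of_hasMultiplicativeReductionAt
    (⟨ℚ, Curve37a.E⟩ : EllPoint) 2 not_admitsLCyclic_two_curve37a
    (v := (Rat.HeightOneSpectrum.primesEquiv (R := 𝓞 ℚ)).symm ⟨37, by norm_num⟩)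
    (curve37a_hasMultiplicativeReductionAt_of_mem mem_primesEquiv_symm_37) ?_ ?_
  · exact_mod_cast not_mem_two_of_mem_37 mem_primesEquiv_symm_37
  · show ¬ 2 ∣ Curve37a.E.ordMinimalDiscriminant _
    rw [ordMinimalDiscriminant_curve37a]
    norm_num

/-- `EllPoint.ImageModLContainsSL2` is inhabited at the prime level `l = 2`.
[cite: MochizukiGenEll2010, Thm 3.8 p.19] -/
theorem exists_imageModLContainsSL2_two : ∃ P : EllPoint, P.ImageModLContainsSL2 2 :=
  ⟨_, imageModLContainsSL2_two_curve37a⟩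

/-- The degenerate level `l = 1`: `E[1] = 0`, so the (vacuous) containment "every determinant-`1`
endomorphism of `E[1]` is a Galois element" holds for every presented curve (with `σ = 1`).
[cite: MochizukiGenEll2010, Thm 3.8 p.19] -/
theorem imageModLContainsSL2_one (P : EllPoint) : P.ImageModLContainsSL2 1 := by
  unfold EllPoint.ImageModLContainsSL2
  intro f _
  refine ⟨1, fun x => ?_⟩
  have hx : x = 0 := by
    apply Subtype.ext
    have h := AddSubgroup.torsionBy.nsmul_iff.mp x.2
    rwa [one_nsmul] at h
  subst hx
  rw [smul_zero, map_zero]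

end Literature.NumberTheory.DiophantineGeometry.GenEll

end
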